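import Literature.Analysis.Complex.HarmonicRemovableSingularity
import Mathlib.Analysis.Complex.Harmonic.Liouville

/-!
# Harmonic functions off a finite set: bounded singularities and bounded at infinity ⇒ constant

**Theorem (classical).** Let `S ⊆ ℂ` be finite and `d : ℂ → ℝ` harmonic on `ℂ ∖ S`, bounded on a
punctured neighbourhood of each point of `S`, and bounded outside some disc. Then `d` is constant on
`ℂ ∖ S`. [folklore] (Removable singularities, `HarmonicRemovableSingularity.lean`, then Liouville's
theorem for harmonic functions, Mathlib's
`InnerProductSpace.bounded_harmonic_on_complex_plane_is_constant`.)

This is the uniqueness mechanism of H. Duminil-Copin, K. K. Kozlowski, P. Lammers, I. Manolescu,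
*Gaussian free field convergence of the six-vertex model with `-1 ≤ Δ ≤ -1/2`*, arXiv:2603.06268
(2026), Part II §2, proof of Theorem 48: two candidates for `Ψ_k(·, u₁', …)` that are harmonic off
the marked points, have the same logarithmic singular parts (so their difference is locally bounded),
both tend to constants at infinity and agree at one point must coincide
(`eqOn_of_harmonic_off_finite`). [cite: DKLM2026SixVertexGFF, Part II, §2, proof of Theorem 48]
-/

noncomputable section

open Complex InnerProductSpace Metric Set Filter Topology Bornology

namespace Literature.Analysis.Complex

/-- **Harmonic off a finite set, locally bounded at the singularities and bounded at infinity ⇒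
constant.** [folklore] -/
theorem exists_eq_const_of_harmonic_off_finite (T : Finset ℂ) {d : ℂ → ℝ}
    (hd : ∀ z ∉ (T : Set ℂ), HarmonicAt d z)
    (hloc : ∀ s ∈ T, ∃ ε > 0, ∃ M : ℝ, ∀ z ∈ ball s ε \ {s}, |d z| ≤ M)
    (hinf : ∃ r M : ℝ, ∀ z : ℂ, r ≤ ‖z‖ → |d z| ≤ M) :
    ∃ c : ℝ, ∀ z ∉ (T : Set ℂ), d z = c := by
  induction T using Finset.induction_on generalizing d with
  | empty =>
    -- harmonic on all of `ℂ` and bounded: Liouville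
    obtain ⟨r, M, hM⟩ := hinf
    have hharm : HarmonicOnNhd d univ := fun z _ => hd z (by simp)
    obtain ⟨B, hB⟩ : ∃ B, ∀ z ∈ closedBall (0 : ℂ) r, ‖d z‖ ≤ B :=
      (isCompact_closedBall (0 : ℂ) r).exists_bound_of_continuousOn (hharm.continuousOn.mono (subset_univ _))
    have hbdd : IsBounded (range d) := by
      rw [isBounded_iff_forall_norm_le]
      refine ⟨max B M, ?_⟩
      rintro _ ⟨z, rfl⟩
      rcases le_or_gt r ‖z‖ with h | h
      · exact ((Real.norm_eq_abs _).le.trans (hM z h)).trans (le_max_right _ _)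
      · exact (hB z (mem_closedBall_zero_iff.2 h.le)).trans (le_max_left _ _)
    refine ⟨d 0, fun z _ => ?_⟩
    exact InnerProductSpace.bounded_harmonic_on_complex_plane_is_constant d hharm hbdd z 0
  | @insert s T hsT ih =>
    -- remove the singularity at `s`
    obtain ⟨ε₀, hε₀, M, hM⟩ := hloc s (Finset.mem_insert_self s T)
    -- a radius avoiding the other singular points
    obtain ⟨ε₁, hε₁, hε₁T⟩ : ∃ ε₁ > 0, ∀ t ∈ T, ε₁ ≤ dist t s := by
      by_cases hT : T.Nonempty
      · refine ⟨T.inf' hT fun t => dist t s, ?_, fun t ht => Finset.inf'_le _ ht⟩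
        obtain ⟨t, ht, heq⟩ := Finset.exists_mem_eq_inf' hT fun t => dist t s
        rw [heq]
        exact dist_pos.2 fun h => hsT (h ▸ ht)
      · exact ⟨1, one_pos, fun t ht => (hT ⟨t, ht⟩).elim⟩
    set ε : ℝ := min ε₀ ε₁ with hε
    have hεpos : 0 < ε := lt_min hε₀ hε₁
    have hball : ∀ z ∈ ball s ε \ {s}, z ∉ (↑(insert s T) : Set ℂ) := by
      rintro z ⟨hz, hzs⟩ hzT
      rw [Finset.coe_insert, mem_insert_iff] at hzT
      rcases hzT with rfl | hzT
      · exact hzs rfl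
      · have := hε₁T z hzT
        rw [mem_ball] at hz
        linarith [min_le_right ε₀ ε₁]
    obtain ⟨U, hU, hUd⟩ := exists_harmonicOnNhd_ball_eqOn_of_bounded (u := d) (M := M) hεpos
      (fun z hz => hd z (hball z hz)) (fun z hz => hM z ⟨ball_subset_ball (min_le_left _ _) hz.1, hz.2⟩)
    -- the function with the singularity at `s` removed
    set d' : ℂ → ℝ := fun z => if z = s then U s else d z with hd'
    have hd'_ne : ∀ z, z ≠ s → d' z = d z := fun z hz => by simp only [hd', if_neg hz]
    have hd'U : d' =ᶠ[𝓝 s] U := by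
      filter_upwards [ball_mem_nhds s hεpos] with z hz
      by_cases hzs : z = s
      · subst hzs
        simp only [hd', if_pos rfl]
      · rw [hd'_ne z hzs]
        exact (hUd ⟨hz, hzs⟩).symm
    have h1 : ∀ z ∉ (T : Set ℂ), HarmonicAt d' z := by
      intro z hz
      by_cases hzs : z = s
      · subst hzs
        exact (harmonicAt_congr_nhds hd'U).2 (hU z (mem_ball_self hεpos))
      · have heq : d' =ᶠ[𝓝 z] d := by
          filter_upwards [eventually_ne_nhds hzs] with w hw
          exact hd'_ne w hw
        refine (harmonicAt_congr_nhds heq).2 (hd z ?_)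
        rw [Finset.coe_insert, mem_insert_iff]
        push Not
        exact ⟨hzs, hz⟩
    have h2 : ∀ t ∈ T, ∃ ε > 0, ∃ M : ℝ, ∀ z ∈ ball t ε \ {t}, |d' z| ≤ M := by
      intro t ht
      obtain ⟨εt, hεt, Mt, hMt⟩ := hloc t (Finset.mem_insert_of_mem ht)
      have hts : 0 < dist t s := dist_pos.2 fun h => hsT (h ▸ ht)
      refine ⟨min εt (dist t s), lt_min hεt hts, Mt, ?_⟩
      rintro z ⟨hz, hzt⟩
      have hzs : z ≠ s := by
        intro hzs
        rw [hzs, mem_ball] at hz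
        linarith [min_le_right εt (dist t s), dist_comm s t]
      rw [hd'_ne z hzs]
      exact hMt z ⟨ball_subset_ball (min_le_left _ _) hz, hzt⟩
    have h3 : ∃ r M : ℝ, ∀ z : ℂ, r ≤ ‖z‖ → |d' z| ≤ M := by
      obtain ⟨r, M', hM'⟩ := hinf
      refine ⟨max r (‖s‖ + 1), M', fun z hz => ?_⟩
      have hzs : z ≠ s := by
        intro hzs
        rw [hzs] at hz
        linarith [le_max_right r (‖s‖ + 1)]
      rw [hd'_ne z hzs]
      exact hM' z ((le_max_left _ _).trans hz)
    obtain ⟨c, hc⟩ := ih h1 h2 h3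
    refine ⟨c, fun z hz => ?_⟩
    rw [Finset.coe_insert, mem_insert_iff] at hz
    push Not at hz
    rw [← hd'_ne z hz.1]
    exact hc z hz.2

/-- **Uniqueness (DKLM Part II §2).** Two real functions on `ℂ`, harmonic off a finite set `T`,
whose difference is bounded near each point of `T` (same singular parts) and bounded at infinity
(both tend to constants), and which agree at one point off `T`, agree off `T`.
[cite: DKLM2026SixVertexGFF, Part II, §2, proof of Theorem 48] -/
theorem eqOn_of_harmonic_off_finite (T : Finset ℂ) {f₁ f₂ : ℂ → ℝ}
    (h₁ : ∀ z ∉ (T : Set ℂ), HarmonicAt f₁ z) (h₂ : ∀ z ∉ (T : Set ℂ), HarmonicAt f₂ z)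
    (hloc : ∀ s ∈ T, ∃ ε > 0, ∃ M : ℝ, ∀ z ∈ ball s ε \ {s}, |f₁ z - f₂ z| ≤ M)
    (hinf : ∃ r M : ℝ, ∀ z : ℂ, r ≤ ‖z‖ → |f₁ z - f₂ z| ≤ M)
    {z₀ : ℂ} (hz₀ : z₀ ∉ (T : Set ℂ)) (heq : f₁ z₀ = f₂ z₀) :
    ∀ z ∉ (T : Set ℂ), f₁ z = f₂ z := by
  obtain ⟨c, hc⟩ := exists_eq_const_of_harmonic_off_finite T (d := fun z => f₁ z - f₂ z)
    (fun z hz => (h₁ z hz).sub (h₂ z hz)) hloc hinf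
  intro z hz
  have h0 : c = 0 := by rw [← hc z₀ hz₀]; simp [heq]
  have := hc z hz
  rw [h0] at this
  simpa [sub_eq_zero] using this

end Literature.Analysis.Complex

end
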